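import Literature.MathematicalPhysics.QuantumLattice.TypeClassSidecarReaderTTPrime
import Literature.MathematicalPhysics.QuantumLattice.TypeClassSidecarReaderTPrimeTransport
import HarnessLib

/-!
# The `t–t'` Markov certificate with a `T = 0` row as cold input (no `t'` transport): the cold-cell / cold-ray reader of the
# cuprate box for GENUINE `t–t'` certificates

Topic `MathematicalPhysics/QuantumLattice` (family `hubbard`); sequel of `TypeClassSidecarReaderTTPrime.lean` (C2 cold input + `t–t'`
Markov certificate, every torus) and `TypeClassSidecarReaderTPrimeTransport.lean` (the same with a `t' = 0` certificate TRANSPORTED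
along `t'`, and its `T = 0`-row edition). This file is the missing fourth corner: a `t–t'` Markov certificate AT `(β_h, t, t', U)`
(corner representative `cornerEnergyRepTT'`, no transport price) chorded with a `T = 0` row `e(t, t', U, n) ≤ e⁺` as the zero-entropy
cold input — the shape of every cold cell (`β ≥ 4`) and cold ray of the cuprate box once genuine `t–t'` certificates exist:

* `IsTorusLimitOfMixture.meanEnergy_hubbardTTPrime_le_of_energyDensity_le_of_rectMarkovCertificateTT'` — for every torus limit
  `ω` of the canonical sector Gibbs states at `(β, t, t', U, n)` (`U ≥ 0`, `0 ≤ n < 2`, `0 < β_h < β`):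
  `e_Φ(ω) ≤ ((c − β_h μ n) + β e⁺)/(β − β_h)`.

Everything is PROVED; no definition, no named fact. WHAT THIS IS NOT: no certificate; the finite-dimensional PSD fact is the claim node
of the cell that uses this reader.

## Mathlib / tree search

REUSED: `eventually_log_partitionFn_sectorHamiltonianTT'_le_of_clusterCertificateTT'` and the rectangle bookkeeping exactly as in
`…le_of_c2Check_of_rectMarkovCertificateTT'_allTori` (`TypeClassSidecarReaderTTPrime`), `eventually_neg_mul_le_log_partitionFn_sectorHamiltonianTT'`
(zero-entropy floor), `IsTorusLimitOfMixture.meanEnergy_hubbardTTPrime_le_of_eventually_pressure_bounds` (`HubbardThermalAxisWindow`).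
`lean search 'rectMarkovCertificateTT'` (2026-08-27): only the C2-input editions.

## References

* R. B. Israel, *Convexity in the Theory of Lattice Gases* (1979), Lemma II.3.1. [cite: Israel1979, Lemma II.3.1]
* D. Poulin, M. B. Hastings, Phys. Rev. Lett. 106 (2011) 080403, eqs. (3)–(8). [cite: PoulinHastings2011, eqs. (3)–(8)]
* D. Ruelle, *Statistical Mechanics: Rigorous Results* (1969), §3.4. [cite: Ruelle1969, §3.4]
-/

noncomputable section

namespace Literature.MathematicalPhysics.QuantumLattice

open Matrix Finset HubbardWave0 Literature.Probability.LatticeModels ThermodynamicLimit AndersonCluster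
open _root_.Filter
open scoped _root_.Topology ComplexOrder BigOperators

namespace InfVolFermionState

variable {t t' U n β : ℝ} {ω : InfVolFermionState 2} {Ls : ℕ → ℕ}

/-- **Cold cell from a GENUINE `t–t'` Markov certificate and a `T = 0` row.** `ω` a torus limit of the canonical sector Gibbs
states at `(β, t, t', U, n)` (`U ≥ 0`, `0 ≤ n < 2`), `0 < β_h < β`; a `T = 0` row `e(t, t', U, n) ≤ e⁺`; C1 data on `rectWindow a' b'`
(`a', b' ≥ 2`) at `(β_h, μ)` with the `t–t'` corner representative `cornerEnergyRepTT'` and constant `c`. Then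
`e_Φ(ω) ≤ ((c − β_h μ n) + β e⁺)/(β − β_h)` — the hot chord with the zero-entropy cold input, no transport term.
[cite: Israel1979, Lemma II.3.1] [cite: PoulinHastings2011, eqs. (3)–(8)] [cite: Ruelle1969, §3.4] -/
theorem IsTorusLimitOfMixture.meanEnergy_hubbardTTPrime_le_of_energyDensity_le_of_rectMarkovCertificateTT'
    (hU : 0 ≤ U) (hn0 : 0 ≤ n) (hn2 : n < 2)
    (h : ω.IsTorusLimitOfMixture (sectorGibbsCount n) (fun L => sectorGibbsWeightTT' β t t' U n L)
      (fun L => sectorGibbsVectorTT' t t' U n L) Ls)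
    (hLs : Tendsto Ls atTop atTop) {βh : ℝ} (hβh : 0 < βh) (hlt : βh < β)
    -- `T = 0` row at `(t, t', U, n)`
    {eup : ℝ} (he : energyDensityTT' t t' U n ≤ eup)
    -- C1 at `(βh, t, t', U)`
    (μ : ℝ) {a' b' : ℕ} (ha' : 2 ≤ a') (hb' : 2 ≤ b')
    {ι : Type*} (sι : Finset ι) (Sw : ι → Finset (Site 2)) (hS : ∀ i, Sw i ⊆ rectWindow a' b') (zw : ι → Site 2)
    (hzw : ∀ i, shiftSet (zw i) (Sw i) ⊆ rectWindow a' b') {O : ∀ i, FermionOp (Sw i)}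
    (hO : ∀ i ∈ sι, (O i).IsHermitian) (g : ι → ℝ)
    {LB : FermionOp ((rectWindow a' b').erase (mkSite2 (a' - 1) (b' - 1)))} (hLB : LB.IsHermitian) {c : ℝ}
    (hcert : ((Real.exp c : ℂ) • cfc Real.exp LB -
      fermionPartialTrace (PolySite.incl (Finset.erase_subset (mkSite2 (a' - 1) (b' - 1)) (rectWindow a' b')))
        (cfc Real.exp (-((βh : ℂ) • (cornerEnergyRepTT' (rectWindow a' b') (mkSite2 (a' - 1) (b' - 1)) t t' U μ +
            windowAnnihilator sι (rectWindow a' b') Sw hS zw hzw O g)) +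
          fermionEmbed (PolySite.incl (Finset.erase_subset (mkSite2 (a' - 1) (b' - 1)) (rectWindow a' b'))) LB))).PosSemidef) :
    ω.meanEnergy (hubbardTTPrimeFermionInteraction t t' U) 1 ≤ ((c - βh * μ * n) + β * eup) / (β - βh) := by
  have hβ : 0 < β := hβh.trans hlt
  have hAc := rectCorner_mem_rectWindow (a := a') (b := b') (by omega) (by omega)
  -- hot input at `(βh, t, t', U)` from the `t–t'` certificate
  have hu : ∀ ε : ℝ, 0 < ε → ∀ᶠ j in atTop,
      Real.log (partitionFn βh (sectorHamiltonianTT' t t' U n (Ls j))).re ≤ ((c - βh * μ * n) + ε) * (Ls j : ℝ) ^ 2 :=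
    fun ε hε => eventually_log_partitionFn_sectorHamiltonianTT'_le_of_clusterCertificateTT' t t' U μ βh hn0 hn2.le hLs
      hAc toLex_le_toLex_rectCorner (rectWindow_subset_halfOpenBox_max a' b')
      (fun i => bondWeightSum_cornerBondWeight hAc (rectCorner_sub_unitVec_mem_rectWindow ha' hb' i))
      (diagBondWeightSum_cornerDiagBondWeight hAc (rectCorner_sub_unitVec_mem_rectWindow ha' hb' 0)
        (rectCorner_sub_unitVec_mem_rectWindow ha' hb' 1) (rectCorner_sub_unitVec_sub_unitVec_mem_rectWindow ha' hb'))
      (siteWeightSum_cornerSiteWeight hAc) (siteWeightSum_mul_cornerSiteWeight hAc (-μ))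
      (isHermitian_windowAnnihilator sι _ Sw hS zw hzw hO g)
      (fun L _ hL3 hℓL => trace_window_mul_windowAnnihilator
        (relabel_translate_gibbsDensity L (relabel_translate_hubbardTorusTT'_sub_mu (L := L) t t' U μ) βh)
        _ sι Sw hS zw hzw O g) hLB hcert hε
  -- cold input `W = −β e⁺`
  have hW : ∀ ε : ℝ, 0 < ε → ∀ᶠ j in atTop,
      (-(β * eup) - ε) * (Ls j : ℝ) ^ 2 ≤ Real.log (partitionFn β (sectorHamiltonianTT' t t' U n (Ls j))).re := by
    intro ε hε
    have hε' : 0 < ε / β := div_pos hε hβ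
    filter_upwards [eventually_neg_mul_le_log_partitionFn_sectorHamiltonianTT' t t' hU hn0 hn2 hβ.le hLs hε']
      with j hj
    refine le_trans (mul_le_mul_of_nonneg_right ?_ (by positivity)) hj
    have : β * (ε / β) = ε := by field_simp
    nlinarith [mul_le_mul_of_nonneg_left he hβ.le]
  have hmain := h.meanEnergy_hubbardTTPrime_le_of_eventually_pressure_bounds hn0 hn2.le hLs hβh hlt hW hu
  refine hmain.trans (le_of_eq ?_)
  ring

/-- **RANGE form** (cold cell on `β ≥ β₁`): with the data of
`…le_of_energyDensity_le_of_rectMarkovCertificateTT'` and `0 ≤ (c − β_h μ n) + β_h e⁺`, for every `β ≥ β₁ > β_h` the cap at `β₁`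
bounds every torus limit at `β`: `e_Φ(ω) ≤ ((c − β_h μ n) + β₁ e⁺)/(β₁ − β_h)` (`markovChordBound_anti`).
[cite: Israel1979, Lemma II.3.1] [cite: PoulinHastings2011, eqs. (3)–(8)] -/
theorem IsTorusLimitOfMixture.meanEnergy_hubbardTTPrime_le_on_range_of_energyDensity_le_of_rectMarkovCertificateTT'
    (hU : 0 ≤ U) (hn0 : 0 ≤ n) (hn2 : n < 2) {β₁ : ℝ} (hβ₁ : β₁ ≤ β)
    (h : ω.IsTorusLimitOfMixture (sectorGibbsCount n) (fun L => sectorGibbsWeightTT' β t t' U n L)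
      (fun L => sectorGibbsVectorTT' t t' U n L) Ls)
    (hLs : Tendsto Ls atTop atTop) {βh : ℝ} (hβh : 0 < βh) (hlt : βh < β₁)
    {eup : ℝ} (he : energyDensityTT' t t' U n ≤ eup)
    (μ : ℝ) {a' b' : ℕ} (ha' : 2 ≤ a') (hb' : 2 ≤ b')
    {ι : Type*} (sι : Finset ι) (Sw : ι → Finset (Site 2)) (hS : ∀ i, Sw i ⊆ rectWindow a' b') (zw : ι → Site 2)
    (hzw : ∀ i, shiftSet (zw i) (Sw i) ⊆ rectWindow a' b') {O : ∀ i, FermionOp (Sw i)}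
    (hO : ∀ i ∈ sι, (O i).IsHermitian) (g : ι → ℝ)
    {LB : FermionOp ((rectWindow a' b').erase (mkSite2 (a' - 1) (b' - 1)))} (hLB : LB.IsHermitian) {c : ℝ}
    (hcert : ((Real.exp c : ℂ) • cfc Real.exp LB -
      fermionPartialTrace (PolySite.incl (Finset.erase_subset (mkSite2 (a' - 1) (b' - 1)) (rectWindow a' b')))
        (cfc Real.exp (-((βh : ℂ) • (cornerEnergyRepTT' (rectWindow a' b') (mkSite2 (a' - 1) (b' - 1)) t t' U μ +
            windowAnnihilator sι (rectWindow a' b') Sw hS zw hzw O g)) +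
          fermionEmbed (PolySite.incl (Finset.erase_subset (mkSite2 (a' - 1) (b' - 1)) (rectWindow a' b'))) LB))).PosSemidef)
    (hA : 0 ≤ (c - βh * μ * n) + βh * eup) :
    ω.meanEnergy (hubbardTTPrimeFermionInteraction t t' U) 1 ≤ ((c - βh * μ * n) + β₁ * eup) / (β₁ - βh) := by
  have h1 := h.meanEnergy_hubbardTTPrime_le_of_energyDensity_le_of_rectMarkovCertificateTT' hU hn0 hn2 hLs hβh
    (hlt.trans_le hβ₁) he μ ha' hb' sι Sw hS zw hzw hO g hLB hcert
  exact h1.trans (markovChordBound_anti hA hlt hβ₁)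

end InfVolFermionState

end Literature.MathematicalPhysics.QuantumLattice

end
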